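import Literature.NumberTheory.DiophantineGeometry.SUnitAbcBoundsCongruenceNumberProofs
import Literature.NumberTheory.EllipticCurves.CongruenceNumberLevelBoundExplicitProofs
import Literature.NumberTheory.EllipticCurves.SUnitFreyHellegouarchLemmaTenFiveProofs
import Literature.NumberTheory.DiophantineGeometry.ConductorRadicalProofs
import HarnessLib

/-!
# Murty–Pasten 2013, §8: the Frey–Hellegouarch curve of a triple `A + B = C` (Diamond–Kramer
# exponent `2⁴`) and the explicit `abc` bound the argument yields on {modularity, Mazur–Kenku}

Topic `Literature/NumberTheory/DiophantineGeometry` (family `abc`; LADDER-ABC A1, the *modular method*).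
A proofs-only companion (theorems only; NO definition, NO new named fact, nothing restated; D-0014,
D-0026) of `SUnitAbcBoundsCongruenceNumber.lean` (M. R. Murty, H. Pasten, *Modular forms and
effective Diophantine approximation*, J. Number Theory **133** (2013) 3739–3754 [`MurtyPasten2013`],
Thms 1.1–1.2 typed as named facts). Version of record HELD (`paper:url-b819d9c52ca6`), §8 read at
pp. 3752–3753:

> *Proof of Theorem 1.2.* "Given `A, B, C` non-zero coprime integers with `A + B + C = 0` we can
> assume that `A ≡ −1 (4)` and `B` is even. As usual, we consider the Frey–Hellegouarch curve
> `E : y² = x(x − A)(x + B)`. Then the minimal discriminant of `E` satisfies `2⁸|Δ_E| ≥ (ABC)²` … and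
> the conductor of `E` satisfies `N_E ∣ 2⁴ rad(ABC)` (see [Diamond–Kramer]). Write `R = rad(ABC)`,
> then applying Theorem 7.1 to `E` we get `log(ABC)² − 8 log 2 < 1.2 · 2⁴R log(2⁴R) + 93` … say that
> `1 ≤ |A| ≤ |B| ≤ |C|`, then `max{|A|,|B|,|C|} = |C| ≤ |C · 2B|^{1/2} ≤ |2ABC|^{1/2}` and we have
> `4 log max{|A|,|B|,|C|} − 2 log 2 < 19.2 R log R + 53.234 R + 98.546` …"

## Contents (all PROVED)

* `MurtyPasten.exists_freyCurve_of_abc` — §8's curve for a signed coprime `A + B = C` (the tree's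
  convention for `A + B + C = 0`): an elliptic `W/ℚ` with `N_W ∣ 2⁴ rad(ABC)`, `(ABC)² ≤ 2⁸ Δ_min(W)`,
  and `rad(ABC) ∣ 2 N_W`. In the tree this is von Känel–Matschke's Lemma 10.5 — a THEOREM
  (`vonKanelMatschke_lemma_10_5_holds`: normalisation `A ≡ −1 (4)`, `2 ∣ B`; Diamond–Kramer's
  `2`-exponent; Bombieri–Gubler's minimal equations) — applied with `S` = the prime factors of `ABC`,
  plus `rad(N_W) = rad(Δ_min(W))` (`radical_conductorNorm_eq_holds`).
* `MurtyPasten.four_mul_log_max_le` — the display `4 log max{|A|,|B|,|C|} ≤ log|Δ| + 10 log 2`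
  whenever `(ABC)² ≤ 2⁸|Δ|` (`max² ≤ 2|ABC|`).
* `MurtyPasten.abc_log_max_lt_weak_of_modularity_mazurKenku` — §8's explicit computation run on the
  form of Thm 7.1 the tree PROVES from {modularity with an integral Manin constant
  `nonempty_modularParametrizationData`, Mazur–Kenku `PastenShimura2024_minimalDegree_le_163_mul`}
  (`log|Δ_E| < 1.2 N log N + 148`, `log_minimalDiscriminant_lt_148_of_modularity_mazurKenku`):
  **`log max{|A|,|B|,|C|} < 4.8 R log R + 13.31 R + 38.75` for ALL coprime non-zero `A + B = C`.**
  NOT a printed statement — DERIVED constants: the printed Thm 1.2 is `4.8 R log R + 13 R + 25`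
  (named fact `abc_log_max_lt`), which the §8 argument does not reach (`1.2 · 2⁴ log 2⁴ / 4 = 13.31`;
  ERRATUM recorded in `SUnitAbcBoundsCongruenceNumber.lean`; the printed statement follows from
  von Känel–Matschke's Prop. 10.2, `abc_log_max_lt_of_vonKanelMatschke`). The leading
  `4.8 = 1.2 · 2⁴/4` IS reached — it is the Diamond–Kramer exponent `2⁴` that the sibling
  `EllipticCurves.bakerShapeBound_one_one_of_modularity_mazurKenku` (`κ = 6834.4`, bookkeeping
  `N ∣ 2¹⁰ rad`) did not have; `abcTriple_log_lt_weak_of_modularity_mazurKenku` is the `IsABCTriple`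
  form (`log c < 4.8 R log R + 13.31 R + 38.75`; it yields the sibling's shape statement
  `Literature.Barriers.ABC.BakerShapeBound 1 1` with `κ = 53` — `13.31 R ≤ 19.3 R log R`,
  `38.75 ≤ 28.9 R log R` for `R ≥ 2` — which, being the same `Prop`, is not restated here).

The asymptotic clauses ("For the second part one does the same computation using the second part of
Theorem 7.1") are in the companion `SUnitAbcBoundsCongruenceNumberAsymptoticProofs.lean`. No `abc`
claim (shape `θ₀ = 1`, conditional on two named facts); typed ≠ endorsed. Axioms standard.

## References

* [MurtyPasten2013] M. R. Murty, H. Pasten, J. Number Theory 133 (2013) 3739–3754: Thm 1.2 (p. 3741),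
  Thm 7.1 (pp. 3751–3752), §8 (pp. 3752–3753). doi:10.1016/j.jnt.2013.05.006.
* [DiamondKramer1995] F. Diamond, K. Kramer, *Modularity of a family of elliptic curves*, Math. Res.
  Lett. 2 (1995) 299–304 (MP's reference [4] for `N_E ∣ 2⁴ rad(ABC)`).
* [VonkanelMatschke2023] R. von Känel, B. Matschke, Mem. AMS 286 (2023) = arXiv:1605.06079,
  Lemma 10.5 (the normalised Frey–Hellegouarch curve; tree theorem `vonKanelMatschke_lemma_10_5_holds`).
-/

noncomputable section

open Height UniqueFactorizationMonoid WeierstrassCurve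

namespace Literature.NumberTheory.DiophantineGeometry

namespace MurtyPasten

open VonKanelMatschke Literature.NumberTheory.EllipticCurves.ModularForms

/-! ### The curve of §8 -/

/-- `rad(2⁸) = 2` in `ℕ`. [folklore] -/
private theorem radical_two_pow_eight : radical ((2 : ℕ) ^ 8) = 2 := by
  rw [Nat.radical_eq_prod_primeFactors, Nat.primeFactors_prime_pow (by norm_num) Nat.prime_two,
    Finset.prod_singleton]

/-- **The Frey–Hellegouarch curve of §8** (MP p. 3752: "`E` … has minimal discriminant `Δ` satisfying
`2⁸|Δ| ≥ (ABC)²` and conductor `N` dividing `2⁴ rad(ABC)` (by [Diamond–Kramer])"): for coprime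
non-zero `A + B = C` there is an elliptic curve `W/ℚ` with `N_W ∣ 2⁴ rad(ABC)`, `(ABC)² ≤ 2⁸ Δ_min(W)`
and `rad(ABC) ∣ 2 N_W`. In the tree: von Känel–Matschke's Lemma 10.5 (PROVED,
`vonKanelMatschke_lemma_10_5_holds`) with `S` the prime factors of `ABC`, and `rad(N_W) = rad(Δ_min(W))`.
[cite: MurtyPasten2013, §8 (proof of Thm 1.2, p. 3752)] [cite: DiamondKramer1995] -/
theorem exists_freyCurve_of_abc {a b c : ℤ} (ha : a ≠ 0) (hb : b ≠ 0) (hc : c ≠ 0)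
    (habc : a + b = c) (hg : Int.gcd (Int.gcd a b : ℤ) c = 1) :
    ∃ (W : WeierstrassCurve ℚ) (_ : W.IsElliptic),
      W.conductorNorm ℤ ∣ 2 ^ 4 * radical (a * b * c).natAbs ∧
      (a * b * c).natAbs ^ 2 ≤ 2 ^ 8 * W.minimalDiscriminantNorm ℤ ∧
      radical (a * b * c).natAbs ∣ 2 * W.conductorNorm ℤ := by
  classical
  have habc0 : (a * b * c).natAbs ≠ 0 := Int.natAbs_ne_zero.mpr (by positivity)
  set S : Finset ℕ := (a * b * c).natAbs.primeFactors with hSdef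
  have hS : ∀ p ∈ S, p.Prime := fun p hp => Nat.prime_of_mem_primeFactors hp
  have hP : primesProd S = radical (a * b * c).natAbs := by
    rw [primesProd, hSdef, Nat.radical_eq_prod_primeFactors]
  obtain ⟨W, W', hW, hW', -, hN, -, hΔ, -⟩ :=
    vonKanelMatschke_lemma_10_5_holds S hS a b c ha hb hc habc hg (hP ▸ dvd_rfl)
  refine ⟨W, hW, hP ▸ hN, ?_, ?_⟩
  · rcases hΔ with h | h
    · rw [h]
      have : (a * b * c).natAbs ^ 2 ≤ 2 ^ 4 * (a * b * c).natAbs ^ 2 := Nat.le_mul_of_pos_left _ (by norm_num)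
      calc (a * b * c).natAbs ^ 2 ≤ 2 ^ 4 * (a * b * c).natAbs ^ 2 := this
        _ ≤ 2 ^ 8 * (2 ^ 4 * (a * b * c).natAbs ^ 2) := Nat.le_mul_of_pos_left _ (by norm_num)
    · exact h.ge
  · -- `n² ∣ 2⁸ Δ`, so `rad n = rad(n²) ∣ rad(2⁸) rad(Δ) = 2 rad(N) ∣ 2 N`
    have hdvd : (a * b * c).natAbs ^ 2 ∣ 2 ^ 8 * W.minimalDiscriminantNorm ℤ := by
      rcases hΔ with h | h
      · rw [h]; exact Dvd.dvd.mul_left (Dvd.intro_left _ rfl) _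
      · exact h ▸ dvd_rfl
    have hne : 2 ^ 8 * W.minimalDiscriminantNorm ℤ ≠ 0 := by
      intro h0
      rcases hΔ with h | h
      · rw [h] at h0
        exact absurd h0 (by positivity)
      · rw [h0] at h
        exact absurd h.symm (by positivity)
    have h1 : radical ((a * b * c).natAbs) ∣ radical (2 ^ 8 * W.minimalDiscriminantNorm ℤ) := by
      rw [← radical_pow ((a * b * c).natAbs) two_ne_zero]
      exact radical_dvd_radical hdvd hne
    have h2 : radical (2 ^ 8 * W.minimalDiscriminantNorm ℤ) ∣ 2 * radical (W.conductorNorm ℤ) := by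
      have h := radical_mul_dvd (a := (2 : ℕ) ^ 8) (b := W.minimalDiscriminantNorm ℤ)
      rw [radical_two_pow_eight] at h
      rwa [(WeierstrassCurve.radical_conductorNorm_eq_holds W :
        radical (W.conductorNorm ℤ) = radical (W.minimalDiscriminantNorm ℤ))]
    exact h1.trans (h2.trans (mul_dvd_mul_left 2 radical_dvd_self))

/-- `M² ≤ 2 |ABC|` for `M = max{|A|,|B|,|C|}`, `A + B = C` non-zero integers: the largest of
`|A|, |B|, |C|` is the sum of the other two, and `x + y ≤ 2xy` for `x, y ≥ 1`. [folklore] -/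
private theorem max_natAbs_sq_le_two_mul_natAbs {a b c : ℤ} (ha : a ≠ 0) (hb : b ≠ 0) (hc : c ≠ 0)
    (habc : a + b = c) :
    (max a.natAbs (max b.natAbs c.natAbs)) ^ 2 ≤ 2 * (a * b * c).natAbs := by
  have hx : 1 ≤ a.natAbs := Int.natAbs_pos.mpr ha
  have hy : 1 ≤ b.natAbs := Int.natAbs_pos.mpr hb
  have hz : 1 ≤ c.natAbs := Int.natAbs_pos.mpr hc
  have hcases : a.natAbs + b.natAbs = c.natAbs ∨ a.natAbs + c.natAbs = b.natAbs ∨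
      b.natAbs + c.natAbs = a.natAbs := by omega
  have key : ∀ x y z : ℕ, 1 ≤ x → 1 ≤ y → x + y = z →
      (max x (max y z)) ^ 2 ≤ 2 * (x * y * z) := by
    intro x y z hx hy hxyz
    have hmax : max x (max y z) = z := by
      rw [max_eq_right (le_max_of_le_right (by omega)), max_eq_right (by omega)]
    rw [hmax]
    have : z ≤ 2 * (x * y) := by nlinarith
    nlinarith
  rw [Int.natAbs_mul, Int.natAbs_mul]
  rcases hcases with h | h | h
  · exact key _ _ _ hx hy h
  · have h' := key _ _ _ hx hz h
    have e1 : max a.natAbs (max c.natAbs b.natAbs) = max a.natAbs (max b.natAbs c.natAbs) := by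
      rw [max_comm c.natAbs]
    have e2 : a.natAbs * c.natAbs * b.natAbs = a.natAbs * b.natAbs * c.natAbs := by ring
    rwa [e1, e2] at h'
  · have h' := key _ _ _ hy hz h
    have e1 : max b.natAbs (max c.natAbs a.natAbs) = max a.natAbs (max b.natAbs c.natAbs) := by
      rw [max_comm c.natAbs, max_left_comm]
    have e2 : b.natAbs * c.natAbs * a.natAbs = a.natAbs * b.natAbs * c.natAbs := by ring
    rwa [e1, e2] at h'

/-- `max{|A|,|B|,|C|}` as the cast of `max` of the `natAbs`. [folklore] -/
private theorem max_abs_eq_cast_max_natAbs (a b c : ℤ) :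
    max |a| (max |b| |c|) = ((max a.natAbs (max b.natAbs c.natAbs) : ℕ) : ℤ) := by
  simp only [Nat.cast_max, Int.natCast_natAbs]

/-- **§8, first display: `4 log max{|A|,|B|,|C|} ≤ log|Δ| + 10 log 2`** whenever
`(ABC)² ≤ 2⁸|Δ|` (`4 log max − 2 log 2 ≤ 2 log|ABC| ≤ log|Δ| + 8 log 2`), for non-zero integers
`A + B = C`. [cite: MurtyPasten2013, §8 (proof of Thm 1.2, p. 3752, first display)] -/
theorem four_mul_log_max_le {a b c : ℤ} (ha : a ≠ 0) (hb : b ≠ 0) (hc : c ≠ 0)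
    (habc : a + b = c) {Δ : ℕ} (hΔ : (a * b * c).natAbs ^ 2 ≤ 2 ^ 8 * Δ) :
    4 * Real.log ((max |a| (max |b| |c|) : ℤ) : ℝ) ≤ Real.log (Δ : ℝ) + 10 * Real.log 2 := by
  rw [max_abs_eq_cast_max_natAbs, Int.cast_natCast]
  set M : ℕ := max a.natAbs (max b.natAbs c.natAbs) with hMdef
  have hM1 : 1 ≤ M := le_max_of_le_left (Int.natAbs_pos.mpr ha)
  have hMpos : (0 : ℝ) < (M : ℝ) := by exact_mod_cast hM1
  have hn0 : (a * b * c).natAbs ≠ 0 := Int.natAbs_ne_zero.mpr (by positivity)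
  have hnpos : (0 : ℝ) < ((a * b * c).natAbs : ℝ) := by exact_mod_cast Nat.pos_of_ne_zero hn0
  have h1 : ((M : ℝ)) ^ 2 ≤ 2 * ((a * b * c).natAbs : ℝ) := by
    exact_mod_cast max_natAbs_sq_le_two_mul_natAbs ha hb hc habc
  have h2 : ((a * b * c).natAbs : ℝ) ^ 2 ≤ 2 ^ 8 * (Δ : ℝ) := by exact_mod_cast hΔ
  have hΔpos : (0 : ℝ) < (Δ : ℝ) := by
    have : (0:ℝ) < ((a * b * c).natAbs : ℝ) ^ 2 := by positivity
    nlinarith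
  have e1 : Real.log ((M : ℝ) ^ 2) = 2 * Real.log (M : ℝ) := by
    rw [Real.log_pow]; norm_num
  have e2 : Real.log (((a * b * c).natAbs : ℝ) ^ 2) = 2 * Real.log ((a * b * c).natAbs : ℝ) := by
    rw [Real.log_pow]; norm_num
  have e3 : Real.log ((2 : ℝ) ^ 8) = 8 * Real.log 2 := by
    rw [Real.log_pow]; norm_num
  have hl1 : 2 * Real.log (M : ℝ) ≤ Real.log 2 + Real.log ((a * b * c).natAbs : ℝ) := by
    rw [← e1, ← Real.log_mul (by norm_num) hnpos.ne']
    exact Real.log_le_log (by positivity) h1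
  have hl2 : 2 * Real.log ((a * b * c).natAbs : ℝ) ≤ 8 * Real.log 2 + Real.log (Δ : ℝ) := by
    rw [← e2, ← e3, ← Real.log_mul (by norm_num) hΔpos.ne']
    exact Real.log_le_log (by positivity) h2
  linarith

/-! ### The explicit computation of §8 on the tree's form of Thm 7.1 -/

/-- `x log x` is monotone on `[1, ∞)`. [folklore] -/
private theorem mul_log_le_mul_log_of_one_le {x y : ℝ} (hx : 1 ≤ x) (hxy : x ≤ y) :
    x * Real.log x ≤ y * Real.log y :=
  mul_le_mul hxy (Real.log_le_log (by linarith) hxy) (Real.log_nonneg hx) (by linarith)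

/-- **§8's explicit computation run on `log|Δ_E| < 1.2 N log N + 148`** (the form of Thm 7.1's
discriminant clause the tree PROVES from modularity and Mazur–Kenku,
`log_minimalDiscriminant_lt_148_of_modularity_mazurKenku`; print has `+ 93`, ERRATUM in
`CongruenceNumberLevelBound.lean`): for ALL coprime non-zero integers `A + B = C`,
`log max{|A|,|B|,|C|} < 4.8 R log R + 13.31 R + 38.75`, `R = rad(ABC)`
(`4 log max ≤ log|Δ_E| + 10 log 2 < 1.2 · 16R log(16R) + 148 + 10 log 2`). NOT a printed statement:
the printed Thm 1.2 has `13 R + 25` (named fact `abc_log_max_lt`, which the §8 argument does not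
reach — `1.2 · 2⁴ log 2⁴ / 4 = 13.31`; it follows from von Känel–Matschke's Prop. 10.2 instead,
`abc_log_max_lt_of_vonKanelMatschke`). Recorded as the explicit bound MP's method yields in the
kernel on the base {modularity, Mazur–Kenku}. [cite: MurtyPasten2013, §8 (proof of Thm 1.2, p. 3752) with Thm 7.1] -/
theorem abc_log_max_lt_weak_of_modularity_mazurKenku (hmod : nonempty_modularParametrizationData)
    (h163 : PastenShimura2024_minimalDegree_le_163_mul) {a b c : ℤ} (ha : a ≠ 0) (hb : b ≠ 0)
    (hc : c ≠ 0) (habc : a + b = c) (hg : Int.gcd (Int.gcd a b : ℤ) c = 1) :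
    Real.log ((max |a| (max |b| |c|) : ℤ) : ℝ) <
      4.8 * ((radical (a * b * c).natAbs : ℕ) : ℝ) * Real.log ((radical (a * b * c).natAbs : ℕ) : ℝ) +
        13.31 * ((radical (a * b * c).natAbs : ℕ) : ℝ) + 38.75 := by
  obtain ⟨W, hW, hN, hΔ, -⟩ := exists_freyCurve_of_abc ha hb hc habc hg
  have hNpos : 0 < W.conductorNorm ℤ := WeierstrassCurve.conductorNorm_pos_holds W
  set R : ℝ := ((radical (a * b * c).natAbs : ℕ) : ℝ) with hRdef
  have hR1 : (1 : ℝ) ≤ R := by rw [hRdef]; exact_mod_cast Nat.radical_pos _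
  have hN16 : ((W.conductorNorm ℤ : ℕ) : ℝ) ≤ 16 * R := by
    have h := Nat.le_of_dvd (by positivity) hN
    rw [hRdef]; exact_mod_cast h
  have h3 := EllipticCurves.MurtyPasten.log_minimalDiscriminant_lt_148_of_modularity_mazurKenku
    hmod h163 W
  have h4 := four_mul_log_max_le ha hb hc habc hΔ
  set N : ℝ := ((W.conductorNorm ℤ : ℕ) : ℝ) with hNdef
  have hN1 : (1 : ℝ) ≤ N := by rw [hNdef]; exact_mod_cast hNpos
  have hNlogN : N * Real.log N ≤ 16 * R * Real.log (16 * R) := mul_log_le_mul_log_of_one_le hN1 hN16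
  have hlog16R : Real.log (16 * R) = Real.log 16 + Real.log R :=
    Real.log_mul (by norm_num) (by linarith)
  have hl16 : Real.log 16 ≤ 2.7725887232 := by
    have h16 : Real.log 16 = 4 * Real.log 2 := by
      rw [show (16 : ℝ) = 2 ^ 4 by norm_num, Real.log_pow]; norm_num
    have := Real.log_two_lt_d9
    linarith
  have hl2 := Real.log_two_lt_d9
  have hlogR : 0 ≤ Real.log R := Real.log_nonneg hR1
  have e : 16 * R * Real.log (16 * R) = 16 * Real.log 16 * R + 16 * R * Real.log R := by
    rw [hlog16R]; ring
  nlinarith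

/-- **The explicit bound for `abc` triples on the base {modularity, Mazur–Kenku}**: every coprime
positive `a + b = c` has `log c < 4.8 R log R + 13.31 R + 38.75`, `R = rad(abc)` (the tree's
`IsABCTriple` / `rad` currency; derived constants, see `abc_log_max_lt_weak_of_modularity_mazurKenku`
— print's Thm 1.2 has `13 R + 25`). [cite: MurtyPasten2013, §8 (proof of Thm 1.2, p. 3752) with Thm 7.1] -/
theorem abcTriple_log_lt_weak_of_modularity_mazurKenku (hmod : nonempty_modularParametrizationData)
    (h163 : PastenShimura2024_minimalDegree_le_163_mul) {a b c : ℕ} (ht : IsABCTriple a b c) :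
    Real.log c < 4.8 * (rad a b c : ℝ) * Real.log (rad a b c : ℕ) + 13.31 * (rad a b c : ℝ) + 38.75 := by
  obtain ⟨ha, hb, habc, hcop⟩ := ht
  have hc : 0 < c := by omega
  have hg : Int.gcd (Int.gcd (a : ℤ) b : ℤ) c = 1 := by
    simp [Int.gcd_natCast_natCast, Nat.Coprime.gcd_eq_one hcop]
  have h1 := abc_log_max_lt_weak_of_modularity_mazurKenku hmod h163 (a := a) (b := b) (c := c)
    (by exact_mod_cast ha.ne') (by exact_mod_cast hb.ne') (by exact_mod_cast hc.ne')
    (by exact_mod_cast habc) hg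
  have hmax : (max |(a : ℤ)| (max |(b : ℤ)| |(c : ℤ)|) : ℤ) = c := by
    rw [Nat.abs_cast, Nat.abs_cast, Nat.abs_cast]
    have : (a : ℤ) ≤ c ∧ (b : ℤ) ≤ c :=
      ⟨by exact_mod_cast (by omega : a ≤ c), by exact_mod_cast (by omega : b ≤ c)⟩
    rw [max_eq_right this.2, max_eq_right this.1]
  have hrad : radical ((a : ℤ) * b * c).natAbs = rad a b c := by
    rw [rad_def, show ((a : ℤ) * b * c) = ((a * b * c : ℕ) : ℤ) by push_cast; ring,
      Int.natAbs_natCast]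
  rw [hmax, hrad] at h1
  exact_mod_cast h1

end MurtyPasten

end Literature.NumberTheory.DiophantineGeometry

end
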